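import Mathlib
import HarnessLib.Audit
import Summits.PneNP.PneNP.Theorems.PstarMinimalCoreClean

/-!
# SAFE families: a recursive combinatorial certificate that a family carries no terminal pair (ROUND-24, O1/O2; memo g23 §27)

FRONTIER range-avoidance ladder, rung F-N3, ROUND 24 (cell `pnp-ideate`, prover-2 memo `g23/O1-TWOCLEAN-g23.md` §27; typed targets
`PstarCoreBoundTargets.TerminalPeelable` / `TerminalFive` (p646951); restricted-model proof complexity — nothing here bears on `P` versus `NP`).

`PstarMinimalCoreClean.false_of_two_clean_criterion`: a terminal core dies as soon as two distinct outside-gated chords satisfy `NoShortCoincidence`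
(combinatorial) and `NoPathSumSubcore` (no TERMINAL path-sum sub-core).  The latter is again a statement "no terminal pair on a smaller family", so the
whole criterion UNWINDS into a recursive, purely combinatorial certificate on the pair (family `K`, menu `M` of monomial outputs):

* `Safe I K M` (inductive): `K` has two distinct outside-gated chords `e, e'` (menu `M`) satisfying `NoShortCoincidence`, and every non-empty XOR-closed
  `K₁` inside `K ∖ e` or inside `K ∖ e'` is `Safe` for every menu `M₁ ⊆ M ∪ (K ∖ K₁)` (the sub-core's readers fold outputs of `K ∖ K₁`);
* `Safe.anti` — antitone in the menu; `Safe.intro_max` — it suffices to certify the sub-families for the MAXIMAL menus `M ∪ (K ∖ K₁)`;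
* **`not_terminal_of_safe`** — `Safe I K M` ⟹ no reader pair `(d₁, d₂)` with monomials inside `M` makes `(K, d₁, d₂)` a terminal core
  (induction on the certificate: the sub-certificates discharge `NoPathSumSubcore`, then `false_of_two_clean_criterion`);
* `safe_of_minimal` — a minimally XOR-closed family with two outside-gated chords is `Safe` (the base case; `PstarMinimalCoreClean`);
* `Safe.of_internal` / `false_of_safe_internal` — ONLY `J`-INTERNAL MONOMIALS MATTER (`J ⊇ K` any ambient family, `varsOf J` its variables): a
  certificate for the menu's monomials with both AND variables inside `varsOf J` certifies every bigger menu, since a monomial with an AND variable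
  outside `J` is an outside gate at every level (`isGate_of_external`).  So the evaluation is FINITE per structure: internal couplings only.

So for a given finite class of structures and menus (the planner's centre families with all admissible menus), "no terminal pair" is reduced to an
exhaustive evaluation of `Safe` — what fails it is the explicit residual where semantics (or O2) is still needed (memo §27: the centre triangle under
a σσ′ menu coupling).  No genericity hypothesis, no Assumption A.
-/

set_option linter.dupNamespace false -- `Summit.PneNP.PneNP.…`: summit = sub-problem name (D-0017 single-conjunct layout)

open Finset Literature.Computability.Complexity
open Summit.PneNP.PneNP.Theorems.PstarTyped (Typed)
open Summit.PneNP.PneNP.Theorems.PstarSALevel (varSet bdry BoundaryExpanding SimpleOverlap)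
open Summit.PneNP.PneNP.Theorems.PstarCoreBound (XorClosed)
open Summit.PneNP.PneNP.Theorems.PstarChordRepair (IsChord)
open Summit.PneNP.PneNP.Theorems.PstarCoreBoundTargets (Terminal)
open Summit.PneNP.PneNP.Theorems.PstarChordBridgeTools (xpdeg)
open Summit.PneNP.PneNP.Theorems.PstarChordReadSwitches (Touches)
open Summit.PneNP.PneNP.Theorems.PstarCentreFree (vars_mem_varSet)
open Summit.PneNP.PneNP.Theorems.PstarChordReadOutside (IsGate OutsideGated)
open Summit.PneNP.PneNP.Theorems.PstarProductRank (IsInducedMatching)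
open Summit.PneNP.PneNP.Theorems.PstarSliceGenericCriterion (NoPathSumSubcore NoShortCoincidence)
open Summit.PneNP.PneNP.Theorems.PstarMinimalCoreClean (MinimalXorClosed noShortCoincidence_of_minimal false_of_two_clean_criterion)

namespace Summit.PneNP.PneNP.Theorems.PstarSafeCores

variable {n m : ℕ}

/-! ## Antitonicity in the menu -/
section Anti

variable {I : LocalMap 4 n m} {K M M' : Finset (Fin m)} {e : Fin m}

/-- Outside-gatedness is antitone in the menu. -/
theorem outsideGated_anti (h : M' ⊆ M) (hO : OutsideGated I K M e) : OutsideGated I K M' e := fun g hg ht => hO g (h hg) ht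

/-- `NoShortCoincidence` is antitone in the menu (a bigger menu has fewer outside-gated chords, so more families `F₁` to exclude). -/
theorem noShortCoincidence_anti (h : M' ⊆ M) (hB : NoShortCoincidence I K e M) : NoShortCoincidence I K e M' :=
  fun F₁ hF₁ hne hclean heven hch hM => hB F₁ hF₁ hne (fun c' hc' hchc hO => hclean c' hc' hchc (outsideGated_anti h hO)) heven hch hM

end Anti

/-! ## The certificate -/
section SafeDef

variable (I : LocalMap 4 n m)

/-- **`Safe I K M`**: a recursive combinatorial certificate that the family `K` with monomial menu `M` carries no terminal reader pair.  Two distinct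
outside-gated chords `e, e'` of `K` satisfy `NoShortCoincidence`, and every non-empty XOR-closed subfamily avoiding `e` or avoiding `e'` is `Safe`
for every menu inside `M ∪ (K ∖ K₁)`. -/
inductive Safe : Finset (Fin m) → Finset (Fin m) → Prop
  | intro (K M : Finset (Fin m)) (e e' : Fin m) (he : e ∈ K) (he' : e' ∈ K) (hne : e ≠ e') (hch : IsChord I K e) (hch' : IsChord I K e')
      (hO : OutsideGated I K M e) (hO' : OutsideGated I K M e') (hB : NoShortCoincidence I K e M) (hB' : NoShortCoincidence I K e' M)
      (hsub : ∀ K₁ : Finset (Fin m), (K₁ ⊆ K.erase e ∨ K₁ ⊆ K.erase e') → K₁.Nonempty → XorClosed I K₁ →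
        ∀ M₁ ⊆ M ∪ (K \ K₁), Safe K₁ M₁) : Safe K M

variable {I}

/-- `Safe` is antitone in the menu. -/
theorem Safe.anti {K M : Finset (Fin m)} (h : Safe I K M) : ∀ {M'}, M' ⊆ M → Safe I K M' := by
  induction h with
  | intro K M e e' he he' hne hch hch' hO hO' hB hB' hsub _ =>
    intro M' hM'
    exact Safe.intro K M' e e' he he' hne hch hch' (outsideGated_anti hM' hO) (outsideGated_anti hM' hO') (noShortCoincidence_anti hM' hB)
      (noShortCoincidence_anti hM' hB') fun K₁ hK₁ hne₁ hX₁ M₁ hM₁ =>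
        hsub K₁ hK₁ hne₁ hX₁ M₁ (hM₁.trans (union_subset_union hM' (Subset.refl _)))

/-- **Constructor with maximal sub-menus**: it suffices to certify each sub-family for the menu `M ∪ (K ∖ K₁)`. -/
theorem Safe.intro_max {K M : Finset (Fin m)} {e e' : Fin m} (he : e ∈ K) (he' : e' ∈ K) (hne : e ≠ e') (hch : IsChord I K e)
    (hch' : IsChord I K e') (hO : OutsideGated I K M e) (hO' : OutsideGated I K M e') (hB : NoShortCoincidence I K e M)
    (hB' : NoShortCoincidence I K e' M)
    (hsub : ∀ K₁ : Finset (Fin m), (K₁ ⊆ K.erase e ∨ K₁ ⊆ K.erase e') → K₁.Nonempty → XorClosed I K₁ → Safe I K₁ (M ∪ (K \ K₁))) :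
    Safe I K M :=
  Safe.intro K M e e' he he' hne hch hch' hO hO' hB hB' fun K₁ hK₁ hne₁ hX₁ _ hM₁ => (hsub K₁ hK₁ hne₁ hX₁).anti hM₁

end SafeDef

/-! ## Safe families carry no terminal pair -/
section Main

variable {I : LocalMap 4 n m} {r : ℕ} {y : Fin m → Bool}

/-- **A `Safe` family is the core of no terminal pair whose monomials lie in the menu.** -/
theorem not_terminal_of_safe (hI : I.IsPure xorAndPred) (hT : Typed I) (hS : SimpleOverlap I) (hB : BoundaryExpanding r I)
    {K M : Finset (Fin m)} (h : Safe I K M) :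
    ∀ d₁ d₂ : Finset (Fin n) × Finset (Fin m) × Bool, d₁.2.1 ∪ d₂.2.1 ⊆ M → ¬ Terminal I r y K d₁ d₂ := by
  induction h with
  | intro K M e e' he he' hne hch hch' hO hO' hBe hBe' _ ih =>
    intro d₁ d₂ hd ht
    have hOd : OutsideGated I K (d₁.2.1 ∪ d₂.2.1) e := outsideGated_anti hd hO
    have hOd' : OutsideGated I K (d₁.2.1 ∪ d₂.2.1) e' := outsideGated_anti hd hO'
    -- branch (A) for a chord `c ∈ {e, e'}`: every candidate sub-core is Safe, hence not terminal
    have hA : ∀ c : Fin m, (c = e ∨ c = e') → NoPathSumSubcore I r y K c (d₁.2.1 ∪ d₂.2.1) := by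
      intro c hc K₀ hK₀ hne₀ hX₀ F₁ F₂ t d₁' d₂' hF₁ hF₂ hm₁ hm₂ _ _ _ ht₀
      have hK₀' : K₀ ⊆ K.erase e ∨ K₀ ⊆ K.erase e' := by
        rcases hc with rfl | rfl
        exacts [Or.inl hK₀, Or.inr hK₀]
      have hFK : (K.erase c) \ K₀ ⊆ K \ K₀ := sdiff_subset_sdiff (erase_subset c K) (Subset.refl _)
      refine ih K₀ hK₀' hne₀ hX₀ (d₁'.2.1 ∪ d₂'.2.1) ?_ d₁' d₂' (Subset.refl _) ht₀
      refine union_subset ?_ (hm₂.trans (union_subset_union hd (hF₂.trans hFK)))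
      rw [hm₁]
      exact (hF₁.trans hFK).trans subset_union_right
    exact false_of_two_clean_criterion hI hT hS hB ht he he' hne hch hch' hOd hOd' (hA e (Or.inl rfl)) (noShortCoincidence_anti hd hBe)
      (hA e' (Or.inr rfl)) (noShortCoincidence_anti hd hBe')

/-- Pointed form: a `Safe` core with a menu containing both readers' monomials is contradictory. -/
theorem false_of_safe (hI : I.IsPure xorAndPred) (hT : Typed I) (hS : SimpleOverlap I) (hB : BoundaryExpanding r I) {K : Finset (Fin m)}
    {w₁ w₂ : Finset (Fin n) × Finset (Fin m) × Bool} (ht : Terminal I r y K w₁ w₂) (h : Safe I K (w₁.2.1 ∪ w₂.2.1)) : False :=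
  not_terminal_of_safe hI hT hS hB h w₁ w₂ (Subset.refl _) ht

end Main

/-! ## The base case: minimally XOR-closed families -/
section Base

variable {I : LocalMap 4 n m} {K M : Finset (Fin m)} {e e' : Fin m}

/-- **A minimally XOR-closed family with two outside-gated chords is `Safe`** (there are no sub-families to certify). -/
theorem safe_of_minimal (hI : I.IsPure xorAndPred) (hmin : MinimalXorClosed I K) (he : e ∈ K) (he' : e' ∈ K) (hne : e ≠ e')
    (hch : IsChord I K e) (hch' : IsChord I K e') (hO : OutsideGated I K M e) (hO' : OutsideGated I K M e') : Safe I K M := by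
  refine Safe.intro K M e e' he he' hne hch hch' hO hO' (noShortCoincidence_of_minimal hI hmin he he' hne hch' hO')
    (noShortCoincidence_of_minimal hI hmin he' he hne.symm hch hO) fun K₁ hK₁ hne₁ hX₁ M₁ _ => ?_
  exfalso
  have hK₁K : K₁ ⊆ K := by
    rcases hK₁ with h | h
    exacts [h.trans (erase_subset e K), h.trans (erase_subset e' K)]
  have hK : K₁ = K := hmin K₁ hK₁K hne₁ hX₁
  rcases hK₁ with h | h
  · exact (mem_erase.1 (h (hK ▸ he))).1 rfl
  · exact (mem_erase.1 (h (hK ▸ he'))).1 rfl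

end Base

/-! ## Only internal monomials matter -/
section Internal

variable {I : LocalMap 4 n m} (J : Finset (Fin m))

/-- The variables of the family `J`. -/
def varsOf (J : Finset (Fin m)) : Finset (Fin n) := J.biUnion (varSet I)

variable {J}

/-- Membership in `varsOf`. -/
theorem mem_varsOf {v : Fin n} : v ∈ varsOf (I := I) J ↔ ∃ j ∈ J, v ∈ varSet I j := by
  unfold varsOf; rw [mem_biUnion]

/-- A monomial touching a chord of `K ⊆ J` whose AND pair is NOT inside the variables of `J` is an outside gate on that chord. -/
theorem isGate_of_external (hI : I.IsPure xorAndPred) {K : Finset (Fin m)} (hKJ : K ⊆ J) {e g : Fin m} (he : e ∈ K) (ht : Touches I e g)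
    (hext : ¬ (I.vars g 2 ∈ varsOf (I := I) J ∧ I.vars g 3 ∈ varsOf (I := I) J)) : ∃ v z, IsGate I K e g v z := by
  have h23 : I.vars g 2 ≠ I.vars g 3 := fun h => absurd (hI.2 g h) (by decide)
  have memJ : ∀ s : Fin 4, I.vars e s ∈ varsOf (I := I) J := fun s => mem_varsOf.2 ⟨e, hKJ he, vars_mem_varSet I e s⟩
  have outK : ∀ {u : Fin n}, u ∉ varsOf (I := I) J → ∀ j ∈ K, u ∉ varSet I j :=
    fun hu j hj hju => hu (mem_varsOf.2 ⟨j, hKJ hj, hju⟩)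
  -- `Touches`: some AND slot of `g` is a private of `e`
  unfold PstarChordReadSwitches.Touches at ht
  by_cases h2 : I.vars g 2 = I.vars e 2 ∨ I.vars g 2 = I.vars e 3
  · -- slot 2 of `g` is the private; slot 3 must be external
    have h3J : I.vars g 3 ∉ varsOf (I := I) J := fun h3 => hext ⟨by rcases h2 with h | h <;> rw [h] <;> exact memJ _, h3⟩
    rcases h2 with h | h
    · exact ⟨I.vars e 2, I.vars g 3, Or.inl rfl, Or.inl ⟨h, rfl⟩, outK h3J⟩
    · exact ⟨I.vars e 3, I.vars g 3, Or.inr rfl, Or.inl ⟨h, rfl⟩, outK h3J⟩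
  · push Not at h2
    have h3 : I.vars g 3 = I.vars e 2 ∨ I.vars g 3 = I.vars e 3 := by
      by_contra h3; push Not at h3; exact ht ⟨⟨h2.1, h3.1⟩, ⟨h2.2, h3.2⟩⟩
    have h2J : I.vars g 2 ∉ varsOf (I := I) J := fun h2' => hext ⟨h2', by rcases h3 with h | h <;> rw [h] <;> exact memJ _⟩
    rcases h3 with h | h
    · exact ⟨I.vars e 2, I.vars g 2, Or.inl rfl, Or.inr ⟨rfl, h⟩, outK h2J⟩
    · exact ⟨I.vars e 3, I.vars g 2, Or.inr rfl, Or.inr ⟨rfl, h⟩, outK h2J⟩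

/-- Outside-gatedness for a bigger menu whose `J`-internal monomials are already in the certified menu. -/
theorem outsideGated_of_internal (hI : I.IsPure xorAndPred) {K M₀ M : Finset (Fin m)} (hKJ : K ⊆ J) {e : Fin m} (he : e ∈ K)
    (hM : ∀ g ∈ M, I.vars g 2 ∈ varsOf (I := I) J → I.vars g 3 ∈ varsOf (I := I) J → g ∈ M₀) (hO : OutsideGated I K M₀ e) :
    OutsideGated I K M e := by
  intro g hg ht
  by_cases hint : I.vars g 2 ∈ varsOf (I := I) J ∧ I.vars g 3 ∈ varsOf (I := I) J
  · exact hO g (hM g hg hint.1 hint.2) ht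
  · exact isGate_of_external hI hKJ he ht hint

/-- **ONLY `J`-INTERNAL MONOMIALS MATTER**: a certificate for the `J`-internal part of a menu (monomials with both AND variables among the variables
of `J ⊇ K`) is a certificate for the whole menu — a monomial with an AND variable outside `J` is an outside gate at every level of the recursion. -/
theorem Safe.of_internal (hI : I.IsPure xorAndPred) {K M₀ : Finset (Fin m)} (h : Safe I K M₀) :
    ∀ M : Finset (Fin m), K ⊆ J → (∀ g ∈ M, I.vars g 2 ∈ varsOf (I := I) J → I.vars g 3 ∈ varsOf (I := I) J → g ∈ M₀) → Safe I K M := by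
  induction h with
  | intro K M₀ e e' he he' hne hch hch' hO hO' hB hB' _ ih =>
    intro M hKJ hM
    have clean_up : ∀ {c : Fin m}, c ∈ K → OutsideGated I K M₀ c → OutsideGated I K M c :=
      fun hc hOc => outsideGated_of_internal hI hKJ hc hM hOc
    have nsc : ∀ {c : Fin m}, NoShortCoincidence I K c M₀ → NoShortCoincidence I K c M :=
      fun hBc F₁ hF₁ hne₁ hclean heven hchords hmatch =>
        hBc F₁ hF₁ hne₁ (fun c' hc' hchc hOc => hclean c' hc' hchc (clean_up ((erase_subset _ _) (hF₁ hc')) hOc)) heven hchords hmatch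
    refine Safe.intro K M e e' he he' hne hch hch' (clean_up he hO) (clean_up he' hO') (nsc hB) (nsc hB') fun K₁ hK₁ hne₁ hX₁ M₁ hM₁ => ?_
    classical
    have hK₁K : K₁ ⊆ K := by
      rcases hK₁ with h | h
      exacts [h.trans (erase_subset e K), h.trans (erase_subset e' K)]
    refine ih K₁ hK₁ hne₁ hX₁ (M₁.filter fun g => I.vars g 2 ∈ varsOf (I := I) J ∧ I.vars g 3 ∈ varsOf (I := I) J) ?_ M₁
      (hK₁K.trans hKJ) fun g hg h2 h3 => mem_filter.2 ⟨hg, h2, h3⟩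
    intro g hg
    obtain ⟨hgM₁, h2, h3⟩ := mem_filter.1 hg
    rcases mem_union.1 (hM₁ hgM₁) with hgM | hgK
    · exact mem_union_left _ (hM g hgM h2 h3)
    · exact mem_union_right _ hgK

/-- Pointed form: a certificate for the internal monomials of the readers' menu kills the terminal core. -/
theorem false_of_safe_internal {r : ℕ} {y : Fin m → Bool} (hI : I.IsPure xorAndPred) (hT : Typed I) (hS : SimpleOverlap I)
    (hB : BoundaryExpanding r I) {K M₀ : Finset (Fin m)} {w₁ w₂ : Finset (Fin n) × Finset (Fin m) × Bool} (ht : Terminal I r y K w₁ w₂)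
    (hKJ : K ⊆ J) (hM : ∀ g ∈ w₁.2.1 ∪ w₂.2.1, I.vars g 2 ∈ varsOf (I := I) J → I.vars g 3 ∈ varsOf (I := I) J → g ∈ M₀)
    (h : Safe I K M₀) : False :=
  false_of_safe hI hT hS hB ht (h.of_internal hI (w₁.2.1 ∪ w₂.2.1) hKJ hM)

end Internal

end Summit.PneNP.PneNP.Theorems.PstarSafeCores
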